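import Summits.BirchSwinnertonDyer.Uniform.U2.GenusPointRingClass
import Literature.NumberTheory.EllipticCurves.HeegnerHypothesisKroneckerProofs
import Literature.NumberTheory.EllipticCurves.NoEverywhereGoodReductionRat
import Literature.NumberTheory.EllipticCurves.ModularityVersionApProofs
import Literature.NumberTheory.QuadraticFields.HeegnerCondition
import Literature.NumberTheory.QuadraticFields.FundamentalDiscriminant
import Literature.NumberTheory.QuadraticFields.IntegralBasisConjugation
import HarnessLib

/-!
# Cell «bsd-uniform», track U2, route C — T4-PROOF Lemma L1, FIELD HALF, preliminaries: the
# `2`-division cubic and the arithmetic of the Heegner field ((H-Δ) `K ≠ ℚ(√Δ_E)` DISCHARGED)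

HONEST FRAMING (cell «bsd-uniform», run/shared/lean/pub/bsd-uniform/, seat u2-p1): elementary lemmas,
no claim about BSD; nothing booked. They feed `RingClassNoTwoTorsion.lean` (L1 proved: `E(K[n])[2] = 0`,
the binder `h2L` of the end-to-end heads, HOME/RESIDUE.md §U2 row R2-9).

* §1 (the `2`-division cubic, any field `L` of characteristic `0`): a non-zero `2`-torsion point
  `(x, y) ∈ E(L)` has `2y + a₁x + a₃ = 0` (`two_mul_y_add_eq_zero`), so `x` is a root of
  `4X³ + b₂X² + 2b₄X + b₆ = W.twoTorsionPolynomial` (`mem_roots_of_two_nsmul_eq_zero`; Silverman AEC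
  III.§1), and the point is determined by `x` (`eq_of_x_eq`). The `[DecidableEq L]` of Mathlib's
  group law is an instance ARGUMENT (as in the tree's `pointGalHom`), so that the lemmas apply to the
  subfields `K[n] ⊂ ℂ`.
* §2 (the Heegner field): in a quadratic field an irrational `k` with `k² = q ∈ ℚ` has
  `q ∈ d_K·ℚ²` (`exists_eq_sq_mul_discr`: `1, k, √d_K` are `ℚ`-dependent; Marcus Ch. 2 Thm. 1 via
  the tree's `Quadratic.exists_sq_eq_discr`, `not_isSquare_discr`); and **(H-Δ) discharged**:
  `Δ_E ∉ d_K·ℚ²` for `W` globally minimal, `K` imaginary quadratic with `d_K ≡ 1 (mod 4)` and the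
  Heegner hypothesis for `N_E` (`Δ_ne_sq_mul_discr`: a prime `p ∣ d_K` has `p² ∤ d_K` — tree
  `not_sq_dvd_discr_of_prime_ne_two` —, so odd valuation in `Δ_min`, so `p ∣ Δ_min`, `p ∣ N_E`
  (`not_hasGoodReductionAtPrime_of_dvd_minimalDiscriminantInt`,
  `dvd_conductorNorm_iff_not_hasGoodReductionAtPrime`), and `p` would split in `K`
  (`satisfiesHeegnerHypothesis_iff_kronecker`: `(d_K/p) = 1`) while `(d_K/p) = 0`).

References: T4-PROOF.md v1.9b §3 L1 (HOME); Silverman, AEC 2nd ed., III.§1 [SilvermanAEC2009];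
Marcus, *Number Fields*, Ch. 2 Thm. 1; Cox, *Primes of the form x² + ny²*, 2nd ed., §9.A [Cox2013].
-/

noncomputable section

open scoped Classical

open WeierstrassCurve NumberField Literature.NumberTheory.EllipticCurves
  Literature.NumberTheory.EllipticCurves.ModularForms

set_option autoImplicit false

namespace Summit.BirchSwinnertonDyer.Uniform.U2.RingClass

/-! ## §1 Non-zero `2`-torsion points and the roots of the `2`-division cubic -/

section TwoTorsion

variable {L : Type} [Field L] [CharZero L] [DecidableEq L] (W : WeierstrassCurve ℚ)

/-- A non-zero `2`-torsion point `(x, y)` has `2y + a₁x + a₃ = 0` (`P = -P`). [folklore] -/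
theorem two_mul_y_add_eq_zero {x y : L} (h : (W.baseChange L).toAffine.Nonsingular x y)
    (h2 : (2 : ℕ) • (Affine.Point.some x y h) = 0) :
    2 * y + (W.baseChange L).a₁ * x + (W.baseChange L).a₃ = 0 := by
  rw [two_nsmul, add_eq_zero_iff_eq_neg, Affine.Point.neg_some, Affine.Point.some.injEq] at h2
  have := h2.2
  rw [Affine.negY] at this
  linear_combination this

/-- The `x`-coordinate of a non-zero `2`-torsion point is a root of the `2`-division cubic
`4x³ + b₂x² + 2b₄x + b₆` (Silverman AEC III.§1: `(2y + a₁x + a₃)² = 4x³ + b₂x² + 2b₄x + b₆` on the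
curve). [cite: SilvermanAEC2009, III.§1 (2-division polynomial)] -/
theorem mem_roots_of_two_nsmul_eq_zero {x y : L} (h : (W.baseChange L).toAffine.Nonsingular x y)
    (h2 : (2 : ℕ) • (Affine.Point.some x y h) = 0) :
    x ∈ (Cubic.map (algebraMap ℚ L) W.twoTorsionPolynomial).roots := by
  have hψ := two_mul_y_add_eq_zero W h h2
  have heq := (Affine.equation_iff x y).mp h.1
  have hx : 4 * x ^ 3 + (W.baseChange L).b₂ * x ^ 2 + 2 * (W.baseChange L).b₄ * x +
      (W.baseChange L).b₆ = 0 := by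
    simp only [WeierstrassCurve.b₂, WeierstrassCurve.b₄, WeierstrassCurve.b₆]
    linear_combination (2 * y + (W.baseChange L).a₁ * x + (W.baseChange L).a₃) * hψ - 4 * heq
  rw [Cubic.mem_roots_iff (Cubic.ne_zero_of_a_ne_zero (by simp [Cubic.map, twoTorsionPolynomial]))]
  simp only [Cubic.map, twoTorsionPolynomial, map_ofNat, map_mul]
  rw [← hx]
  simp only [WeierstrassCurve.baseChange, WeierstrassCurve.map_b₂, WeierstrassCurve.map_b₄,
    WeierstrassCurve.map_b₆]

/-- Two non-zero `2`-torsion points with the same `x`-coordinate are equal (`Q = -Q`). [folklore] -/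
theorem eq_of_x_eq {x₁ y₁ x₂ y₂ : L} {h₁ : (W.baseChange L).toAffine.Nonsingular x₁ y₁}
    {h₂ : (W.baseChange L).toAffine.Nonsingular x₂ y₂}
    (h2 : (2 : ℕ) • (Affine.Point.some x₂ y₂ h₂) = 0) (hx : x₁ = x₂) :
    Affine.Point.some x₁ y₁ h₁ = Affine.Point.some x₂ y₂ h₂ := by
  rcases (Affine.Point.X_eq_iff (h₁ := h₁) (h₂ := h₂)).mp hx with h | h
  · exact h
  · rw [h]
    rw [two_nsmul, add_eq_zero_iff_eq_neg] at h2
    exact h2.symm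

end TwoTorsion

/-! ## §2 Arithmetic of the Heegner field: `√q ∈ K ∖ ℚ ⇒ q ∈ d_K · ℚ²`; no prime of `d_K` in `Δ` -/

section Quadratic

variable {K : Type} [Field K] [NumberField K]

/-- **In a quadratic field, an irrational square root of a rational number is a rational multiple of
`√d_K`.** If `[K : ℚ] = 2`, `k ∈ K` is not rational and `k² = q ∈ ℚ`, then `q = r² d_K` for some
`r ∈ ℚ` (write `√d_K = a + bk` by counting dimensions; `ab ≠ 0` would make `k` rational, `b = 0`
would make `d_K` a rational square). [folklore] -/
theorem exists_eq_sq_mul_discr (h2 : Module.finrank ℚ K = 2) {k : K} {q : ℚ}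
    (hk : k ∉ Set.range (algebraMap ℚ K)) (hkq : k ^ 2 = algebraMap ℚ K q) :
    ∃ r : ℚ, q = r ^ 2 * NumberField.discr K := by
  obtain ⟨-, -, δ₀, -, hδ₀⟩ := Literature.NumberTheory.QuadraticFields.Quadratic.exists_sq_eq_discr h2
  set θ : K := (δ₀ : K) with hθ
  have hθ2 : θ ^ 2 = algebraMap ℚ K (NumberField.discr K : ℚ) := by
    rw [hθ, ← map_pow, hδ₀]; simp
  -- `1, k, θ` are linearly dependent over `ℚ`
  have hdep : ¬ LinearIndependent ℚ ![(1 : K), k, θ] := by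
    intro hli
    have := hli.fintype_card_le_finrank
    rw [Fintype.card_fin, h2] at this
    omega
  rw [Fintype.not_linearIndependent_iff] at hdep
  obtain ⟨g, hg₀, i, hi⟩ := hdep
  have hg : g 0 • (1 : K) + g 1 • k + g 2 • θ = 0 := by
    simpa [Fin.sum_univ_three, Matrix.vecHead, Matrix.vecTail] using hg₀
  have hk' : ∀ c : ℚ, k ≠ algebraMap ℚ K c := fun c hc => hk ⟨c, hc.symm⟩
  have hsq : ¬ IsSquare (NumberField.discr K) :=
    Literature.NumberTheory.QuadraticFields.Quadratic.not_isSquare_discr h2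
  by_cases hg2 : g 2 = 0
  · -- then `g 0 + g 1 k = 0`: `k` rational or `g = 0`
    exfalso
    rw [hg2, zero_smul, add_zero] at hg
    by_cases hg1 : g 1 = 0
    · rw [hg1, zero_smul, add_zero, smul_eq_zero] at hg
      have hg0 : g 0 = 0 := by simpa using hg
      rcases i with ⟨i, hi3⟩
      interval_cases i
      · exact hi hg0
      · exact hi hg1
      · exact hi hg2
    · apply hk' (-(g 0) / g 1)
      rw [Algebra.algebraMap_eq_smul_one, div_eq_mul_inv, mul_comm, ← smul_smul]
      have : g 1 • k = -(g 0 • (1 : K)) := eq_neg_of_add_eq_zero_right hg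
      rw [← neg_smul] at this
      rw [← this, smul_smul, inv_mul_cancel₀ hg1, one_smul]
  · -- `θ = a + b k` with `a = -g 0 / g 2`, `b = -g 1 / g 2`
    set a : ℚ := -(g 0) / g 2 with ha
    set b : ℚ := -(g 1) / g 2 with hb
    have hθab : θ = algebraMap ℚ K a + b • k := by
      have : g 2 • θ = -(g 0 • (1 : K)) - g 1 • k := by
        rw [eq_sub_iff_add_eq, eq_neg_iff_add_eq_zero, ← hg]; abel
      have h' : θ = (g 2)⁻¹ • (g 2 • θ) := by rw [smul_smul, inv_mul_cancel₀ hg2, one_smul]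
      rw [h', this, ha, hb, Algebra.algebraMap_eq_smul_one, smul_sub, smul_neg, smul_smul, smul_smul]
      rw [div_eq_mul_inv, div_eq_mul_inv, neg_mul, neg_mul, mul_comm (g 0), mul_comm (g 1), neg_smul,
        neg_smul, sub_eq_add_neg]
    -- square: `d_K = a² + b² q + 2ab k`
    have hsqθ : algebraMap ℚ K (NumberField.discr K : ℚ) =
        algebraMap ℚ K (a ^ 2 + b ^ 2 * q) + (2 * a * b) • k := by
      rw [← hθ2, hθab, Algebra.smul_def, Algebra.smul_def, map_add, map_pow, map_mul, map_mul,
        map_mul, map_pow, ← hkq, map_ofNat]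
      ring
    by_cases hab : a * b = 0
    · rw [mul_assoc, hab, mul_zero, zero_smul, add_zero] at hsqθ
      have hinj := (algebraMap ℚ K).injective hsqθ
      rcases mul_eq_zero.mp hab with ha0 | hb0
      · -- `a = 0`: `d_K = b² q`, so `q = (1/b)² d_K`
        have hb0 : b ≠ 0 := by
          intro hb0
          rw [ha0, hb0] at hinj
          exact hsq ⟨0, by exact_mod_cast (by nlinarith [hinj] : (NumberField.discr K : ℚ) = 0)⟩
        refine ⟨b⁻¹, ?_⟩
        rw [hinj, ha0]
        field_simp
        ring
      · -- `b = 0`: `d_K = a²` is a rational square, impossible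
        exfalso
        rw [hb0] at hinj
        have : (NumberField.discr K : ℚ) = a ^ 2 := by linarith [hinj]
        -- a rational square that is an integer is an integer square
        apply hsq
        have hint : IsSquare ((NumberField.discr K : ℤ) : ℚ) := ⟨a, by rw [this, sq]⟩
        exact Rat.isSquare_intCast_iff.mp hint
    · exfalso
      apply hk' ((NumberField.discr K - (a ^ 2 + b ^ 2 * q)) / (2 * a * b))
      have h2ab : (2 * a * b : ℚ) ≠ 0 := by
        intro h; apply hab; linarith [h]
      have : (2 * a * b) • k = algebraMap ℚ K (NumberField.discr K - (a ^ 2 + b ^ 2 * q)) := by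
        rw [map_sub, hsqθ]; ring
      have hk2 : k = (2 * a * b)⁻¹ • ((2 * a * b) • k) := by
        rw [smul_smul, inv_mul_cancel₀ h2ab, one_smul]
      rw [hk2, this, Algebra.smul_def, ← map_mul, div_eq_inv_mul]

end Quadratic

section Discriminant

variable {K : Type} [Field K] [NumberField K]

/-- **`K ≠ ℚ(√Δ_E)` under the Heegner hypothesis.** For `E/ℚ` with globally minimal model `W` and
an imaginary quadratic `K` of odd discriminant in which every prime of the conductor splits,
`Δ_min ∉ d_K · ℚ²`: otherwise an (odd) prime `p ∣ d_K` (`p² ∤ d_K`) has odd valuation in `Δ_min`,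
so `p ∣ Δ_min`, `p ∣ N` (bad reduction), and `p` would split in `K` — but it ramifies
(`(d_K/p) = 0 ≠ 1`). This is hypothesis (H-Δ) of T4-PROOF L1, DISCHARGED. [folklore] -/
theorem Δ_ne_sq_mul_discr (W : WeierstrassCurve ℚ) [W.IsElliptic] [W.IsGloballyMinimal]
    (hK : IsImaginaryQuadratic K) (hD4 : NumberField.discr K % 4 = 1)
    (hH : SatisfiesHeegnerHypothesis (W.conductorNorm ℤ) K) (s : ℚ) :
    W.Δ ≠ s ^ 2 * (NumberField.discr K : ℚ) := by
  intro hs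
  set d : ℤ := NumberField.discr K with hd
  have hdneg : d < 0 := hK.discr_neg
  have hd1 : d.natAbs ≠ 1 := by omega
  obtain ⟨p, hp, hpd⟩ := Nat.exists_prime_and_dvd hd1
  have hpdZ : (p : ℤ) ∣ d := Int.ofNat_dvd_left.mpr hpd
  have hp2 : p ≠ 2 := by
    rintro rfl
    have : (2 : ℤ) ∣ d := hpdZ
    omega
  haveI := Fact.mk hp
  have hpsq : ¬ (p : ℤ) ^ 2 ∣ d :=
    Literature.NumberTheory.QuadraticFields.Quadratic.not_sq_dvd_discr_of_prime_ne_two hK.1 hp hp2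
  have hd0 : d ≠ 0 := hdneg.ne
  -- `v_p(d_K) = 1`
  have hvd : padicValInt p d = 1 := by
    have h1 : 1 ≤ padicValInt p d := by
      rcases (padicValInt_dvd_iff 1 d).mp (by rwa [pow_one]) with h | h
      · exact absurd h hd0
      · exact h
    have h2 : ¬ 2 ≤ padicValInt p d := fun h => hpsq ((padicValInt_dvd_iff 2 d).mpr (Or.inr h))
    omega
  -- `v_p(Δ_min)` is odd, hence `p ∣ Δ_min`
  have hΔ : W.Δ ≠ 0 := W.isUnit_Δ.ne_zero
  have hs0 : s ≠ 0 := by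
    rintro rfl
    rw [zero_pow two_ne_zero, zero_mul] at hs
    exact hΔ hs
  have hdQ : (d : ℚ) ≠ 0 := by exact_mod_cast hd0
  have hval : padicValRat p W.Δ = 2 * padicValRat p s + 1 := by
    rw [hs, padicValRat.mul (pow_ne_zero 2 hs0) hdQ, padicValRat.pow, padicValRat.of_int, hvd]
    push_cast
    ring
  have hpΔ : (p : ℤ) ∣ minimalDiscriminantInt W := by
    by_contra hndvd
    rw [← cast_minimalDiscriminantInt, padicValRat.of_int, padicValInt.eq_zero_of_not_dvd hndvd]
      at hval
    omega
  -- `p ∣ N`, so `p` splits in `K`: `(d_K / p) = 1`; but `p ∣ d_K`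
  have hbad := not_hasGoodReductionAtPrime_of_dvd_minimalDiscriminantInt W p hpΔ
  have hpN : p ∣ W.conductorNorm ℤ := (W.dvd_conductorNorm_iff_not_hasGoodReductionAtPrime p).mpr hbad
  have hkr := ((satisfiesHeegnerHypothesis_iff_kronecker (W.conductorNorm ℤ) K hK.1).mp hH p hp
    hpN).2 hp2
  rw [jacobiSym.mod_left, ← hd, Int.emod_eq_zero_of_dvd hpdZ, jacobiSym.zero_left hp.one_lt] at hkr
  exact zero_ne_one hkr

end Discriminant


end Summit.BirchSwinnertonDyer.Uniform.U2.RingClass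

end
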